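import Summits.BirchSwinnertonDyer.BirchSwinnertonDyer.Theorems.AlignedTransportAtTwoMainConjectureOfRankZeroBSDAtTwoCubicKilfordPrimes
import Summits.BirchSwinnertonDyer.BirchSwinnertonDyer.Theorems.AlignedTransportAtTwoMainConjectureOfRankZeroBSDAtTwoCubicLayerOneRow1727a1
import HarnessLib

/-!
# Route `AlignedTransportAtTwo`, crux C2 `MainConjectureOfRankZeroBSDAtTwo` (stmt-BirchSwinnertonDyer-22298):
# THE ROW AT THE SEED `1727a1` in the class-group currency with ONE displayed bit — «three primes above `2` in `ℚ(e₁)`» is now KERNEL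
# (`Δ_min(1727a1) = −1727 ≡ 1 (mod 8)` ⟹ ON the Kilford stratum ⟹ three primes, att-p5 g26 `…CubicKilfordPrimes`)

HONEST FRAMING (cell `bsd-f1-sign2`, WIDTH-5 attached prover seat `bsd-line-att-p5` gen 26; `--supports` stmt-BirchSwinnertonDyer-22298, closes
nothing; BSD is NOT proved by any of this; the crux and its verdict «blocked-on `Rank1Residual.GreenbergMuConjectureIrreducible`» are untouched).
THEOREMS ONLY. Sequel of att-p5 g25's `…CubicLayerOneRow1727a1` (`mazurMainConjecture_two_1727a1_of_cubicRankLayers`: TWO displayed number-field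
bits `h3p`, `hrank`): here `h3p` is discharged by the kernel dictionary, so the row reads
«`MC₂(1727a1)` ⟸ PRINT⁵ + MuIneqʳ + {`r_an = 0`, analytic `μ₂ = 0`, `BSD₂(1727a1)`} + ONE bit `rank₂ Cl(ℚ(β)·ℚ(ζ₁₆)⁺) = rank₂ Cl(ℚ(β)(√2))`»
(numerically `2 = 2`, cell bsd-2adic kit j300990, GRH as in that job — NOT asserted here).

* `minimalDiscriminantInt_1727a1` (`Δ_min = −1727`), `minimalDiscriminantInt_1727a1_emod_eight` (`≡ 1 (mod 8)`), `onKilfordStratumAtTwo_1727a1`,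
  `three_le_ncard_adjoin_1727a1` (the former bit `h3p`, now a theorem), **`mazurMainConjecture_two_1727a1_of_cubicRankLayer`** — the row.

References: [Fukuda1994] Thm. 1 (2), p. 264; [Kato2004Asterisque] Thm. 17.4 (1)(2); [GreenbergLNM1716] Conj. 1.11, Thm. 4.1; [CremonaAlgorithms1997]
Table 1 (`1727a1`); [NeukirchANT1999] Ch. II §8; [Serre1973] Ch. II §3.3 Thm. 4; tree p743734 (att-p5 g25), `…CubicKilfordPrimes` (g26).
-/

set_option linter.dupNamespace false
set_option autoImplicit false

noncomputable section

open scoped Classical NumberField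

namespace Summit.BirchSwinnertonDyer.BirchSwinnertonDyer.Theorems.AlignedTransportAtTwoCubicKilfordPrimes

open NumberField IsDedekindDomain CongruenceSubgroup WeierstrassCurve Polynomial IntermediateField
  Literature.NumberTheory.GaloisRepresentations Literature.NumberTheory.IwasawaTheory
  Literature.NumberTheory.EllipticCurves
  Literature.NumberTheory.EllipticCurves.ModularForms
  Literature.NumberTheory.EllipticCurves.Rank1Residual
  Literature.NumberTheory.EllipticCurves.Greenberg1999
  Literature.NumberTheory.EllipticCurves.Module
  Summit.BirchSwinnertonDyer.Rank1Residual
  Summit.BirchSwinnertonDyer.Rank1Residual.X1.MuLambda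
  Summit.BirchSwinnertonDyer.Rank1Residual.X5
  Summit.BirchSwinnertonDyer.Rank1Residual.F1Sign2
  Summit.BirchSwinnertonDyer.BirchSwinnertonDyer.Theorems.Rank1ResidualX1Defs
  Summit.BirchSwinnertonDyer.BirchSwinnertonDyer.Theses.AlignedTransportAtTwo
  Summit.BirchSwinnertonDyer.BirchSwinnertonDyer.Theorems.TowerClass
  Summit.BirchSwinnertonDyer.BirchSwinnertonDyer.Theorems.AlignedTransportAtTwoCubicLayerOneDoors
  Summit.BirchSwinnertonDyer.BirchSwinnertonDyer.Theorems.AlignedTransportAtTwoKilfordStratumShared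

/-- `Δ_min(1727a1) = −1727` (Cremona's model is the global minimal model). [cite: CremonaAlgorithms1997, Table 1] -/
theorem minimalDiscriminantInt_1727a1 : minimalDiscriminantInt c1727a1 = -1727 := by
  have h := cast_minimalDiscriminantInt c1727a1
  rw [baseChange_int_Δ, M1727a1_Δ] at h
  exact_mod_cast h

/-- `Δ_min(1727a1) ≡ 1 (mod 8)`. [cite: CremonaAlgorithms1997, Table 1] -/
theorem minimalDiscriminantInt_1727a1_emod_eight : minimalDiscriminantInt c1727a1 % 8 = 1 := by
  rw [minimalDiscriminantInt_1727a1]; decide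

/-- **`1727a1` lies ON the Kilford stratum** (good ordinary at `2`, `Δ_min ≡ 1 (mod 8)`: its `u`-cubic `X³ − 3X² − 1216X + 17600` splits over `ℚ₂`).
[cite: Serre1973, Ch. II §3.3 Thm. 4] [cite: SilvermanAEC2009, VII.2] -/
theorem onKilfordStratumAtTwo_1727a1 : OnKilfordStratumAtTwo c1727a1 :=
  (onKilfordStratumAtTwo_iff_minimalDiscriminantInt_emod_eight c1727a1 goodOrd_two_1727a1).mpr minimalDiscriminantInt_1727a1_emod_eight

/-- **The former bit `h3p` for `1727a1`, now KERNEL**: for every root `β ∈ ℚ̄` of the `2`-division cubic of `1727a1`, the cubic field `ℚ(β)`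
(discriminant `−1727`) has at least three height-one primes containing `2`. [cite: NeukirchANT1999, Ch. II §8, (8.1)–(8.3)] -/
theorem three_le_ncard_adjoin_1727a1 {β : AlgebraicClosure ℚ} (hβ : aeval β c1727a1.twoTorsionPolynomial.toPoly = 0) :
    3 ≤ {v : HeightOneSpectrum (𝓞 ↥(IntermediateField.adjoin ℚ ({β} : Set (AlgebraicClosure ℚ)))) |
      ((2 : ℕ) : 𝓞 ↥(IntermediateField.adjoin ℚ ({β} : Set (AlgebraicClosure ℚ)))) ∈ v.asIdeal}.ncard :=
  three_le_ncard_adjoin_root_twoTorsionPolynomial_of_onKilfordStratumAtTwo c1727a1 goodOrd_two_1727a1 not_hasRationalTwoTorsionX_1727a1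
    onKilfordStratumAtTwo_1727a1 hβ

/-- **THE ROW AT `1727a1`, class-group currency, ONE displayed bit.** Granted PRINT⁵ {Kato 17.4 (1)(2) at `2` for `1727a1` (`h17`), Greenberg 4.1
(`hGr`), period unit (`hper`), modularity (`hmod`), GZK (`hGZK`)}, the registered stub MuIneqʳ verbatim (`hI`), the seed's analytic data (`r_an = 0`,
analytic `μ₂ = 0` on the even branch, `BSD₂(1727a1)`), a root `β` of the `2`-division cubic of `1727a1`, and ONE displayed bit «`rank₂ Cl(ℚ(β)·ℚ(ζ₁₆)⁺) =
rank₂ Cl(ℚ(β)(√2))` for every cyclotomic `ℤ₂`-extension of `ℚ(β)`» (`hrank`; numerically `2 = 2`, bsd-2adic kit j300990, GRH): Mazur's `2`-adic main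
conjecture for `1727a1`. Good ordinary at `2`, no rational `2`-torsion abscissa, `Δ < 0` AND «three primes above `2` in `ℚ(β)`» are KERNEL facts.
[cite: Fukuda1994, Thm. 1 (2), p. 264] [cite: Kato2004Asterisque, Thm. 17.4 (1)(2) (p. 273)] [cite: GreenbergLNM1716, Thm. 4.1 (p. 102) and Conj. 1.11 (p. 58)] -/
theorem mazurMainConjecture_two_1727a1_of_cubicRankLayer
    (h17 : ∀ [NeZero (c1727a1.conductorNorm ℤ)] (f : CuspForm (Gamma0 (c1727a1.conductorNorm ℤ)) 2),
      kato_divisibility_allPrimes c1727a1 2 (f := f))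
    (hGr : Greenberg1999.thm41_charValue_rankZero_anyPrime)
    (hper : realPeriodRat_eq_unit_mul_plusPeriod_two) (hmod : nonempty_modularParametrizationData)
    (hGZK : rank_eq_analyticRank_of_analyticRank_le_one)
    (hI : ∀ (W : WeierstrassCurve ℚ) [W.IsElliptic] [W.IsGloballyMinimal], IsOrdinaryAt W 2 →
      (∀ x : ℚ, ¬ HasRationalTwoTorsionX W x) →
      ∀ (κ : ZpExtension ℚ 2) (γ : Field.absoluteGaloisGroup ℚ), κ.IsCyclotomic →
      κ.IsTopGenerator γ → IsCyclotomicVariable 2 γ →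
      ∀ ⦃N : ℕ⦄ [NeZero N] (f : CuspForm (Gamma0 N) 2), IsNewformOf W f →
      ∀ Gp : IwasawaAlgebra 2, iwasawaToPowerSeries 2 Gp = padicLFunction f (unitRoot W 2 : ℚ_[2]) →
      ∀ (D : W.SelmerDualData κ γ) (Yr : W.FineSelmerDualDataRelaxedInf κ γ),
        lengthAt (IwasawaAlgebra 2) D.X ⟨IwasawaAlgebra.augIdealP 2, IwasawaAlgebra.isPrime_augIdealP_holds 2⟩ ≤
          lengthAt (IwasawaAlgebra 2) (IwasawaAlgebra 2 ⧸ Ideal.span {Gp})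
              ⟨IwasawaAlgebra.augIdealP 2, IwasawaAlgebra.isPrime_augIdealP_holds 2⟩ +
            lengthAt (IwasawaAlgebra 2) Yr.X ⟨IwasawaAlgebra.augIdealP 2, IwasawaAlgebra.isPrime_augIdealP_holds 2⟩)
    (hr0 : c1727a1.analyticRank = 0)
    (hμan : ∀ ⦃N : ℕ⦄ [NeZero N] (f : CuspForm (Gamma0 N) 2), IsNewformOf c1727a1 f →
      ∀ G : IwasawaAlgebra 2, IsEvenBranchLiftAtTwo c1727a1 f G → red G ≠ 0)
    (hbsd : BSDp c1727a1 2)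
    {β : AlgebraicClosure ℚ} (hβ : aeval β c1727a1.twoTorsionPolynomial.toPoly = 0)
    (hrank : ∀ κP : ZpExtension ↥(IntermediateField.adjoin ℚ ({β} : Set (AlgebraicClosure ℚ))) 2, κP.IsCyclotomic →
      classGroupPRank κP 2 = classGroupPRank κP 1) :
    MazurMainConjecture c1727a1 2 :=
  mazurMainConjecture_two_1727a1_of_cubicRankLayers h17 hGr hper hmod hGZK hI hr0 hμan hbsd hβ (three_le_ncard_adjoin_1727a1 hβ) hrank

end Summit.BirchSwinnertonDyer.BirchSwinnertonDyer.Theorems.AlignedTransportAtTwoCubicKilfordPrimes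

end
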